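import Summits.ValiantsHypothesis.ValiantsHypothesis.Theorems.KPlusLogSqLawTropicalBConcatenationRows
import Summits.ValiantsHypothesis.ValiantsHypothesis.Theorems.KPlusLogSqLawGeneralDesignDoubling

/-!
# No bilinear-in-logs real-root law for lacunary symmetric pencils

The bilinear-in-logs law — "log₂ Z₊(m,K) ≤ a·(log₂ m + 1)·(log₂ K + 1) for some absolute a" — is the shape of the
Carstensen–Mulmuley–Shah bumps, of Vinnikov's `K = 3` row and of the `m = 2` rows, and it is the shape of the open stub
`stub_bmd` (`BilinearSemidefiniteDescartes`) of line `Cruxes/MatrixDescartes/Lines/sign_split.lean` (there posed on the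
±semidefinite split class with `V ≤ K' − 1` sign changes).  It is FALSE in the symmetric currency: the kernel tropical
staircase (`Concatenation.staircase_family`: `T(M, L+1) ≥ n^L − 1` at `M ≤ 2^{2L+2} n²`) doubled to real symmetric
pencils (`RealDoubling.not_posRootLawAt_double_of_not_tropRootLawAt`) has `log₂ Z₊ ≈ L·log₂ n` against
`(log₂ m + 1)(log₂ K + 1) ≈ (2L + 2 log₂ n)(log₂ L)`, and `L log n ≫ 2 a log n log L` once `L > 2a log L` and `n → ∞`.
Equivalently: any law `log₂ Z₊ ≤ A(K) + g(K)·log₂ m` needs `g(K) ≥ (K−1)/2`; Conjecture B survives because `log₂² m`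
is not linear in `log₂ m`.  Consequence (located, one line): modulo the T8 stubs `stub_split`/`stub_perturb`/`stub_negRoots`
of line `sign-split`, whose glue turns `stub_bmd` into a bilinear law for ALL symmetric pencils
(`matrixDescartes_of_stubs`, Steps A–C: `Z ≤ 2^{a(log₂ m+1)(log₂ K+2)+3}`), the stub set of that line is inconsistent:
`stub_bmd` is dead as typed.

Ideator val-idea-1 (g0), D-0148 (a), 2026-08-27 — test-before-type applied to the existing law candidates.
0 sorry · 0 axiom · no `native_decide`.
-/

set_option linter.dupNamespace false

namespace Summit.ValiantsHypothesis.ValiantsHypothesis.Theorems.LacunarySymmetroidMatrixDescartes.Census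

open Summit.ValiantsHypothesis.ValiantsHypothesis.Theorems.MatrixDescartes.Negative (PosRootLawAt)
open Summit.ValiantsHypothesis.ValiantsHypothesis.Theorems.KPlusLogSqLaw

/-- arithmetic: `2a(a+6) + 4 ≤ 2^(a+5)`. [arithmetic] -/
theorem two_mul_mul_add_le_two_pow (a : ℕ) : 2 * a * (a + 6) + 4 ≤ 2 ^ (a + 5) := by
  induction a with
  | zero => norm_num
  | succ k ih =>
    rcases Nat.eq_zero_or_pos k with hk | hk
    · subst hk; norm_num
    · have h2 : 2 ^ (k + 1 + 5) = 2 * 2 ^ (k + 5) := by ring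
      rw [h2]
      nlinarith [ih, hk]

/-- **NO-GO (bilinear-in-logs law)**: `¬ ∃ a, ∀ m K, Z₊(m,K) ≤ 2^{a(log₂ m+1)(log₂ K+1)}` — the CMS / Vinnikov /
`m = 2` shape, and the shape of `sign-split`'s `stub_bmd`, fails on the doubled kernel staircase at `K = 2^{a+5}` classes.
[folklore given the tree's staircase and real doubling] -/
theorem noGo_bilinearLogLaw :
    ¬ (∃ a : ℕ, ∀ m K : ℕ, PosRootLawAt m K (2 ^ (a * (Nat.log 2 m + 1) * (Nat.log 2 K + 1)))) := by
  rintro ⟨a, h⟩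
  -- parameters: K = L + 1 = 2^r classes, n = 2^s
  obtain ⟨P, hP⟩ : ∃ P, P = 2 ^ (a + 5) := ⟨_, rfl⟩
  have hPr : 2 * a * (a + 6) + 4 ≤ P := hP ▸ two_mul_mul_add_le_two_pow a
  have hP32 : 32 ≤ P := by
    rw [hP]
    calc (32 : ℕ) = 2 ^ 5 := by norm_num
      _ ≤ 2 ^ (a + 5) := Nat.pow_le_pow_right (by norm_num) (by omega)
  set r : ℕ := a + 5 with hr
  set L : ℕ := P - 1 with hL
  have hL1 : 1 ≤ L := by omega
  have hLsucc : L + 1 = 2 ^ r := by rw [hL, hP]; omega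
  have hKr : Nat.log 2 (L + 1) = r := by rw [hLsucc]; exact Nat.log_pow (by norm_num) r
  set c : ℕ := a * (a + 6) with hc
  set s : ℕ := c * (2 * P + 2) + 1 with hs
  have hs1 : 1 ≤ s := by omega
  set n : ℕ := 2 ^ s with hn
  have hn2 : 2 ≤ n := by
    calc (2 : ℕ) = 2 ^ 1 := by norm_num
      _ ≤ 2 ^ s := Nat.pow_le_pow_right (by norm_num) hs1
  have hne : Even n := by
    rw [hn]
    exact (Nat.even_pow' (by omega)).mpr (by decide)
  -- the kernel staircase, doubled to real symmetric pencils
  have hstair := Concatenation.staircase_family n L hn2 hne hL1 1 le_rfl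
  simp only [one_mul] at hstair
  have hreal := RealDoubling.not_posRootLawAt_double_of_not_tropRootLawAt hstair
  apply hreal
  set M : ℕ := ((2 ^ L - 1) * (n + 1) + 1) * (2 ^ L * n * 2) with hM
  have hlaw := h (M + M) (L + 1)
  refine fun d S hS => (hlaw d S hS).trans ?_
  rw [hKr]
  -- bound log₂ (2M)
  have hMle : M ≤ 2 ^ (2 * L + 2) * n ^ 2 := WalkDesign.staircase_format_le n L (by omega)
  have hn2s : n ^ 2 = 2 ^ (2 * s) := by rw [hn, ← pow_mul]; ring_nf
  have hMM : M + M ≤ 2 ^ (2 * L + 3 + 2 * s) := by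
    have e : 2 ^ (2 * L + 3 + 2 * s) = 2 * (2 ^ (2 * L + 2) * 2 ^ (2 * s)) := by
      rw [show 2 * L + 3 + 2 * s = (2 * L + 2) + (2 * s) + 1 by ring, pow_succ, pow_add]; ring
    rw [e, ← hn2s]
    omega
  have hlog : Nat.log 2 (M + M) ≤ 2 * L + 3 + 2 * s := by
    calc Nat.log 2 (M + M) ≤ Nat.log 2 (2 ^ (2 * L + 3 + 2 * s)) := Nat.log_mono_right hMM
      _ = 2 * L + 3 + 2 * s := Nat.log_pow (by norm_num) _
  -- the exponent is at most s·L − 1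
  have hr1 : r + 1 = a + 6 := by omega
  have hE : a * (Nat.log 2 (M + M) + 1) * (r + 1) + 1 ≤ s * L := by
    have h1 : a * (Nat.log 2 (M + M) + 1) * (r + 1) ≤ a * (2 * L + 4 + 2 * s) * (r + 1) :=
      Nat.mul_le_mul_right _ (Nat.mul_le_mul_left _ (by omega))
    have h2 : a * (2 * L + 4 + 2 * s) * (r + 1) = c * (2 * L + 4 + 2 * s) := by
      rw [hr1, hc]; ring
    have h3 : c * (2 * L + 4 + 2 * s) + 1 = s * (1 + 2 * c) := by
      have : 2 * L + 4 = 2 * P + 2 := by omega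
      rw [this, show c * (2 * P + 2 + 2 * s) = c * (2 * P + 2) + 2 * c * s by ring, hs]
      ring
    have h4 : 2 * c + 4 ≤ P := by
      have : 2 * a * (a + 6) = 2 * c := by rw [hc]; ring
      omega
    have h5 : 1 + 2 * c ≤ L := by omega
    calc a * (Nat.log 2 (M + M) + 1) * (r + 1) + 1
        ≤ c * (2 * L + 4 + 2 * s) + 1 := by rw [← h2]; exact Nat.add_le_add_right h1 1
      _ = s * (1 + 2 * c) := h3
      _ ≤ s * L := Nat.mul_le_mul_left s h5
  -- conclude: 2^E ≤ 2^(sL−1) ≤ 2^(sL) − 2 = n^L − 2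
  have hnL : n ^ L = 2 ^ (s * L) := by rw [hn, ← pow_mul]
  have hsL2 : 2 ≤ s * L := by nlinarith
  have hsplit : 2 ^ (s * L) = 2 * 2 ^ (s * L - 1) := by
    rw [← pow_succ']; congr 1; omega
  have hbig : 2 ≤ 2 ^ (s * L - 1) := by
    calc (2 : ℕ) = 2 ^ 1 := by norm_num
      _ ≤ 2 ^ (s * L - 1) := Nat.pow_le_pow_right (by norm_num) (by omega)
  calc 2 ^ (a * (Nat.log 2 (M + M) + 1) * (r + 1))
      ≤ 2 ^ (s * L - 1) := Nat.pow_le_pow_right (by norm_num) (by omega)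
    _ ≤ 2 ^ (s * L) - 2 := by rw [hsplit]; omega
    _ = n ^ L - 2 := by rw [hnL]

/-- The same no-go with any outer constant: no `A, a` with `Z₊(m,K) ≤ A · 2^{a(log₂ m+1)(log₂ K+1)}` either
(absorb `A ≤ 2^A` into `a`). [folklore] -/
theorem noGo_bilinearLogLaw_const :
    ¬ ∃ A a : ℕ, ∀ m K : ℕ, PosRootLawAt m K (A * 2 ^ (a * (Nat.log 2 m + 1) * (Nat.log 2 K + 1))) := by
  rintro ⟨A, a, h⟩
  apply noGo_bilinearLogLaw
  refine ⟨A + a, fun m K d S hS => (h m K d S hS).trans ?_⟩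
  have hA : A ≤ 2 ^ A := Nat.le_of_lt (Nat.lt_two_pow_self)
  have hx : 1 ≤ (Nat.log 2 m + 1) * (Nat.log 2 K + 1) := Nat.one_le_iff_ne_zero.mpr (by positivity)
  calc A * 2 ^ (a * (Nat.log 2 m + 1) * (Nat.log 2 K + 1))
      ≤ 2 ^ A * 2 ^ (a * (Nat.log 2 m + 1) * (Nat.log 2 K + 1)) := Nat.mul_le_mul_right _ hA
    _ = 2 ^ (A + a * (Nat.log 2 m + 1) * (Nat.log 2 K + 1)) := (pow_add 2 _ _).symm
    _ ≤ 2 ^ ((A + a) * (Nat.log 2 m + 1) * (Nat.log 2 K + 1)) :=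
        Nat.pow_le_pow_right (by norm_num) (by nlinarith)

end Summit.ValiantsHypothesis.ValiantsHypothesis.Theorems.LacunarySymmetroidMatrixDescartes.Census
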